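import Mathlib.LinearAlgebra.PiTensorProduct.Basis
import Literature.IUT.LogVolume.LogVolumeEstimates
import Literature.IUT.LogVolume.PacketDecomposition
import Literature.IUT.LogVolume.PadicSubfields
import Literature.IUT.LogVolume.PacketBases
import HarnessLib

/-!
# The normalised log Haar measure of a tensor packet `K_{v̲_0} ⊗_{ℚ_p} ⋯ ⊗_{ℚ_p} K_{v̲_j}` along a CHOSEN
# decomposition (Dupuy–Hilado Def. 3.6.1, §3.4, §3.7; [IUTchIV] Prop. 1.4 (i))

Dupuy–Hilado, *The statement of Mochizuki's Corollary 3.12*, arXiv:2004.13228 (pre-split text), read on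
the page (render chunks 8, 11–12): Def. 3.6.1 "`log μ̄_{(v̲_0,…,v̲_r)}` … the unique normalized log Haar
measure on the tensor product of fields `K_{v̲_0} ⊗ ⋯ ⊗ K_{v̲_r}` satisfying `log μ̄_{v⃗}(O_{v⃗}) = 0`";
§3.4 "`log μ̄_W := log μ_W / dim_{ℚ_p} W`"; §3.7 "`log μ̄_{(v̲_0,…,v̲_{r−1})}(a_{v̲_{r−1}}·U) = ln|a_{v̲_{r−1}}|_p +
log μ̄(U)`, where the action of `a_{v̲_{r−1}}` on `K_{v̲_0} ⊗ ⋯ ⊗ K_{v̲_{r−1}}` is through the `r`th tensor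
factor". [IUTchIV] Prop. 1.4 (i) (kurims p. 13): "by applying the fact that tensor products of finitely
many finite extensions of `ℚ_p` over `ℤ_p` decompose, naturally, as direct sums of finitely many finite
extensions of `ℚ_p`, we obtain a notion of log-volume … normalized so that `μ^log((R_E)^∼) = 0`".

WHAT THIS FILE DOES. For a packet `V = ⊗_{ℚ_p, i∈I} k_i` (`PacketAlgebra`, abc-iut-S1) of fields of the
cell's norm-side MLF class it FIXES, once and for all, a decomposition `ψ : V ≃ₐ[ℚ_p] Π_j L_j` into finite
subextensions `L_j ⊆ ℚ̄_p` (`exists_packetDecomposition`, abc-iut-S8; the `L_j` are instances of the setting by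
`PadicSubfields.lean`, abc-iut-S1; their Borel structure is declared here) and reads every measure-theoretic
notion through `ψ`:

* `packetVol A := μ_{Π O_{L_j}}(ψ(A))` (outer Haar measure on `⊕_j L_j` normalised by the unit polydisc
  `= ψ((R_I)^∼)`), `PacketAdm A := 0 < packetVol A < ∞` ("measurable sets of positive finite measure", up to
  measurability which no statement needs), `packetLogμ A := μ^log(A) = (1/D)·log μ(ψ(A))` = abc-iut-S8's
  `packetLogVolume` with `D = dim_{ℚ_p} V` — i.e. `log μ̄` of §3.4;
* PROVED: monotonicity on admissible sets; `(R_I)^∼` admissible with `log μ̄ = 0` (the normalisation (3.6));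
  for an element `g ∈ V` with all components `ψ(g)_j ≠ 0` ("nondegenerate", e.g. `ι_i(a)`, `a ∈ k_i^×`, or a
  pure tensor of units, or `p^n`): `g·A` is admissible iff `A` is, and **`log μ̄(g·A) = log μ̄(g·(R_I)^∼) +
  log μ̄(A)`** (the modulus of multiplication by `ψ(g)` on `⊕ L_j`, [AbsTopIII] Prop. 5.7 (i)(b) transported
  through `NormalizedHaar.haar_image`), with **`log μ̄(ι_i(a)·A) = log ‖a‖ + log μ̄(A)`** — (3.7), since every
  component embedding `k_i → L_j` is an isometry (`norm_factorEmb`) and the weights `e_j f_j/D` sum to `1`;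
  and `log μ̄(p^n·A) = −n·log p + log μ̄(A)` (Rmk. 3.5.4 / Lemma 3.5.5 "Mochizuki normalized" in the model).

The choice of `ψ` is immaterial (two decompositions differ by a permutation of isometric factors) but no
statement here needs that, so it is not proved. When abc-iut-S7's intrinsic `tensorLogVolume` (module
topology on `V`) lands, `packetLogVolume_eq_tensorLogVolume` identifies the two by name.
[cite: DupuyHilado2025, Def. 3.6.1, §3.4, §3.7] [cite: Mochizuki2012, IUTchIV Prop. 1.4 (i) p. 13]
Deliberately NOT here: the log-shell lattice, (Ind1)/(Ind2) (next files), anything about Cor. 3.12.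
-/

noncomputable section

open MeasureTheory Set Metric
open scoped TensorProduct NormedField Pointwise ENNReal

namespace Literature.IUT.LogVolume

open Literature.NumberTheory.GaloisRepresentations.Ultrametric

variable (p : ℕ) [Fact p.Prime]
variable {I : Type} [Fintype I] [DecidableEq I]
variable (k : I → Type) [∀ i, NontriviallyNormedField (k i)] [∀ i, NormedAlgebra ℚ_[p] (k i)]
  [∀ i, IsUltrametricDist (k i)] [∀ i, ProperSpace (k i)]

/-! ## The chosen decomposition `ψ : V ≃ Π_j L_j` -/

section Decomposition

omit [DecidableEq I]

/-- The index set `J` of the chosen decomposition `V ≃ Π_{j∈J} L_j` ("direct sums of finitely many finite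
extensions of `ℚ_p`"). [cite: Mochizuki2012, IUTchIV Prop. 1.4 (i) p. 13] -/
def DIdx : Type := (exists_packetDecomposition p k).choose

/-- `J` is finite. [cite: Mochizuki2012, IUTchIV Prop. 1.4 (i) p. 13] -/
instance fintypeDIdx : Fintype (DIdx p k) := (exists_packetDecomposition p k).choose_spec.choose

/-- The factors `L_j ⊆ ℚ̄_p` of the chosen decomposition, as intermediate fields of `ℚ̄_p/ℚ_p`.
[cite: Mochizuki2012, IUTchIV Prop. 1.4 (i) p. 13] -/
def dField : DIdx p k → IntermediateField ℚ_[p] (PadicAlgCl p) :=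
  (exists_packetDecomposition p k).choose_spec.choose_spec.choose

omit [∀ i, IsUltrametricDist (k i)] in
/-- Each factor is finite over `ℚ_p`. [cite: Mochizuki2012, IUTchIV Prop. 1.4 (i) p. 13] -/
theorem dField_finiteDimensional (j : DIdx p k) : FiniteDimensional ℚ_[p] (dField p k j) :=
  (exists_packetDecomposition p k).choose_spec.choose_spec.choose_spec.1 j

/-- The factor `L_j` as a type (a wrapper, so that the ONLY instances on it are the normed ones declared
below — this keeps every instance path through `NontriviallyNormedField`/`NormedAlgebra`, as the
log-volume files of this directory expect). [cite: Mochizuki2012, IUTchIV Prop. 1.4 (i) p. 13] -/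
def DFac (j : DIdx p k) : Type := dField p k j

/-- `L_j` is a nontrivially normed field (the spectral norm of `ℚ̄_p` restricted).
[cite: Mochizuki2012, IUTchIV Prop. 1.1 p. 9] -/
instance nontriviallyNormedField_dFac (j : DIdx p k) : NontriviallyNormedField (DFac p k j) :=
  inferInstanceAs (NontriviallyNormedField (dField p k j))

/-- `L_j` is a normed `ℚ_p`-algebra. [cite: Mochizuki2012, IUTchIV Prop. 1.1 p. 9] -/
instance normedAlgebra_dFac (j : DIdx p k) : NormedAlgebra ℚ_[p] (DFac p k j) :=
  inferInstanceAs (NormedAlgebra ℚ_[p] (dField p k j))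

/-- `L_j` is ultrametric. [cite: Mochizuki2012, IUTchIV Prop. 1.1 p. 9] -/
instance isUltrametricDist_dFac (j : DIdx p k) : IsUltrametricDist (DFac p k j) :=
  inferInstanceAs (IsUltrametricDist (dField p k j))

/-- `L_j` is finite over `ℚ_p`. [cite: Mochizuki2012, IUTchIV Prop. 1.4 (i) p. 13] -/
instance finiteDimensional_dFac (j : DIdx p k) : FiniteDimensional ℚ_[p] (DFac p k j) :=
  dField_finiteDimensional p k j

/-- `L_j` is proper (locally compact; abc-iut-S1's `properSpace_subfield`).
[cite: Mochizuki2012, IUTchIV Prop. 1.1 p. 9] -/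
instance properSpace_dFac (j : DIdx p k) : ProperSpace (DFac p k j) :=
  haveI : FiniteDimensional ℚ_[p] (dField p k j) := dField_finiteDimensional p k j
  inferInstanceAs (ProperSpace (dField p k j))

/-- The Borel σ-algebra on `L_j`. [folklore] -/
instance measurableSpace_dFac (j : DIdx p k) : MeasurableSpace (DFac p k j) := borel _

/-- `L_j` is a Borel space. [folklore] -/
instance borelSpace_dFac (j : DIdx p k) : BorelSpace (DFac p k j) := ⟨rfl⟩

/-- **The chosen decomposition** `ψ : V = ⊗_{ℚ_p} k_i ≃ₐ[ℚ_p] Π_j L_j`.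
[cite: Mochizuki2012, IUTchIV Prop. 1.4 (i) p. 13] -/
def dEquiv : PacketAlgebra p k ≃ₐ[ℚ_[p]] (Π j : DIdx p k, DFac p k j) :=
  (exists_packetDecomposition p k).choose_spec.choose_spec.choose_spec.2.some

omit [∀ i, IsUltrametricDist (k i)] [∀ i, ProperSpace (k i)] in
/-- `V ≠ 0`: the tensor basis is indexed by a nonempty type. [cite: Mochizuki2012, IUTchIV Prop. 1.4 (i) p. 13] -/
theorem nontrivial_packetAlgebra' : Nontrivial (PacketAlgebra p k) := by
  let b : ∀ i, Module.Basis (Module.Free.ChooseBasisIndex ℚ_[p] (k i)) ℚ_[p] (k i) :=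
    fun i ↦ Module.Free.chooseBasis ℚ_[p] (k i)
  let B := Basis.piTensorProduct b
  haveI : ∀ i, Nonempty (Module.Free.ChooseBasisIndex ℚ_[p] (k i)) := fun i ↦ (b i).index_nonempty
  obtain ⟨q⟩ : Nonempty (∀ i, Module.Free.ChooseBasisIndex ℚ_[p] (k i)) := inferInstance
  exact ⟨⟨B q, 0, B.ne_zero q⟩⟩

/-- The chosen decomposition has at least one factor. [cite: Mochizuki2012, IUTchIV Prop. 1.4 (i) p. 13] -/
instance nonempty_dIdx : Nonempty (DIdx p k) := by
  haveI := nontrivial_packetAlgebra' p k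
  by_contra hJ
  rw [not_nonempty_iff] at hJ
  have h01 : (0 : PacketAlgebra p k) = 1 := (dEquiv p k).injective (Subsingleton.elim _ _)
  exact zero_ne_one h01

end Decomposition

/-! ## Volume, admissibility and the normalised log-measure through `ψ` -/

section Volume

/-- The sum `W = ⊕_j L_j = Π_j L_j` of the factors. [cite: Mochizuki2012, IUTchIV Prop. 1.4 (i) p. 13] -/
abbrev DSum : Type := Π j : DIdx p k, DFac p k j

/-- `μ(A) := μ_{Π O_{L_j}}(ψ(A))`: the Haar measure of `⊕_j L_j` normalised by the unit polydisc, read on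
subsets of `V` through `ψ`. [cite: DupuyHilado2025, Def. 3.6.1] -/
def packetVol (A : Set (PacketAlgebra p k)) : ℝ≥0∞ :=
  (piUnitBallStructure (DFac p k)).haar (dEquiv p k '' A)

/-- **Admissible** subsets of the packet: positive finite measure (Def. 3.5.1 "measure space … measurable
sets"; positivity and finiteness are what the log-measure needs). [cite: DupuyHilado2025, Def. 3.5.1] -/
def PacketAdm (A : Set (PacketAlgebra p k)) : Prop := 0 < packetVol p k A ∧ packetVol p k A < ⊤

/-- **`log μ̄_{v⃗}(A)`**: the normalised log-measure `(1/D)·log μ(ψ(A))`, `D = Σ_j e_j f_j = dim_{ℚ_p} V` —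
abc-iut-S8's `packetLogVolume` along the chosen `ψ`. [cite: DupuyHilado2025, §3.4, Def. 3.6.1] -/
def packetLogμ (A : Set (PacketAlgebra p k)) : ℝ := packetLogVolume p k (DFac p k) (dEquiv p k) A

omit [DecidableEq I] [∀ i, IsUltrametricDist (k i)] in
/-- Unfolding `packetLogμ`. [cite: DupuyHilado2025, §3.4] -/
theorem packetLogμ_eq (A : Set (PacketAlgebra p k)) :
    packetLogμ p k A = (piUnitBallStructure (DFac p k)).normalizedLogVolume
      (packetDegree p (DFac p k)) (dEquiv p k '' A) := rfl

omit [DecidableEq I] [∀ i, IsUltrametricDist (k i)] in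
/-- `log μ̄` is monotone on admissible sets. [cite: DupuyHilado2025, Def. 3.5.1] -/
theorem packetLogμ_mono {A B : Set (PacketAlgebra p k)} (hA : PacketAdm p k A) (hB : PacketAdm p k B)
    (h : A ⊆ B) : packetLogμ p k A ≤ packetLogμ p k B :=
  packetLogVolume_mono p k (DFac p k) (dEquiv p k) hA.1 hB.2 h

variable [Nonempty I]

/-- `ψ((R_I)^∼)` is the unit polydisc, i.e. the normalising integral structure of `⊕ L_j`.
[cite: Mochizuki2012, IUTchIV Prop. 1.4 (i) p. 13] -/
theorem image_normalizedPacket_eq_coe :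
    dEquiv p k '' (normalizedPacket p k : Set (PacketAlgebra p k)) =
      (piUnitBallStructure (DFac p k) : Set (DSum p k)) := by
  rw [image_normalizedPacket, coe_piUnitBallStructure]

/-- `μ((R_I)^∼) = 1`. [cite: DupuyHilado2025, §2.4.5] -/
theorem packetVol_normalizedPacket : packetVol p k (normalizedPacket p k) = 1 := by
  rw [packetVol, image_normalizedPacket_eq_coe, IntegralStructure.haar_self]

/-- `(R_I)^∼` is admissible. [cite: DupuyHilado2025, Def. 3.6.1] -/
theorem packetAdm_normalizedPacket : PacketAdm p k (normalizedPacket p k) := by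
  refine ⟨?_, ?_⟩ <;> simp [packetVol_normalizedPacket]

/-- **Normalisation (3.6)**: `log μ̄((R_I)^∼) = 0`. [cite: DupuyHilado2025, Def. 3.6.1] -/
theorem packetLogμ_normalizedPacket : packetLogμ p k (normalizedPacket p k) = 0 :=
  packetLogVolume_normalizedPacket p k (DFac p k) (dEquiv p k)

end Volume

/-! ## Multiplicative translates by nondegenerate elements -/

section Translate

/-- An element of `⊕_j L_j` with all components nonzero is a unit. [folklore] -/
def unitOfNe (y : DSum p k) (hy : ∀ j, y j ≠ 0) : (DSum p k)ˣ :=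
  ⟨y, fun j => (y j)⁻¹, funext fun j => mul_inv_cancel₀ (hy j), funext fun j => inv_mul_cancel₀ (hy j)⟩

/-- Multiplication by a unit of `⊕_j L_j`, as a bicontinuous additive automorphism. [folklore] -/
def mulLeftEquiv (u : (DSum p k)ˣ) : DSum p k ≃ₜ+ DSum p k :=
  { u.mulLeft with
    map_add' := fun x y => mul_add (u : DSum p k) x y
    continuous_toFun := continuous_const.mul continuous_id
    continuous_invFun := continuous_const.mul continuous_id }

omit [DecidableEq I] [∀ i, IsUltrametricDist (k i)] in
/-- `mulLeftEquiv u` acts as `x ↦ u·x`. [cite: MochizukiAbsTopIII2015, Prop. 5.7 (i)(b) p. 138] -/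
@[simp] theorem mulLeftEquiv_apply (u : (DSum p k)ˣ) (x : DSum p k) :
    mulLeftEquiv p k u x = (u : DSum p k) * x := rfl

omit [DecidableEq I] [∀ i, IsUltrametricDist (k i)] in
/-- `ψ(g·A) = ψ(g)·ψ(A)` (multiplicativity of `ψ`). [cite: DupuyHilado2025, §3.7] -/
theorem image_smul_eq (g : PacketAlgebra p k) (A : Set (PacketAlgebra p k)) :
    dEquiv p k '' (g • A) = (fun y ↦ dEquiv p k g * y) '' (dEquiv p k '' A) := by
  rw [← image_smul, image_image, image_image]
  refine image_congr fun a _ ↦ ?_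
  rw [smul_eq_mul, map_mul]

variable [Nonempty I]

/-- **The modulus rule**: for `g ∈ V` with all components `ψ(g)_j ≠ 0`,
`μ(g·A) = μ(g·(R_I)^∼)·μ(A)` ([AbsTopIII] Prop. 5.7 (i)(b) "`μ(x·A) = μ̇(x)·μ(A)`" on `⊕ L_j`).
[cite: MochizukiAbsTopIII2015, Prop. 5.7 (i)(b) p. 138] -/
theorem packetVol_smul (g : PacketAlgebra p k) (hg : ∀ j, dEquiv p k g j ≠ 0) (A : Set (PacketAlgebra p k)) :
    packetVol p k (g • A) = packetVol p k (g • (normalizedPacket p k : Set (PacketAlgebra p k))) *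
      packetVol p k A := by
  let u := unitOfNe p k (dEquiv p k g) hg
  have hφ : ∀ B : Set (DSum p k), (fun y ↦ dEquiv p k g * y) '' B = mulLeftEquiv p k u '' B := fun B => rfl
  unfold packetVol
  rw [image_smul_eq, image_smul_eq, hφ, hφ, image_normalizedPacket_eq_coe]
  exact (piUnitBallStructure (DFac p k)).haar_image (mulLeftEquiv p k u) _

/-- `g·(R_I)^∼` has positive finite measure (it is the polydisc of radii `‖ψ(g)_j‖`).
[cite: Mochizuki2012, IUTchIV Prop. 1.4 (i) p. 13] -/
theorem packetAdm_smul_normalizedPacket (g : PacketAlgebra p k) (hg : ∀ j, dEquiv p k g j ≠ 0) :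
    PacketAdm p k (g • (normalizedPacket p k : Set (PacketAlgebra p k))) :=
  ⟨haar_image_smul_normalizedPacket_pos p k (DFac p k) (dEquiv p k) g hg,
    haar_image_smul_normalizedPacket_lt_top p k (DFac p k) (dEquiv p k) g hg⟩

/-- Nondegenerate translates of admissible sets are admissible. [cite: DupuyHilado2025, §3.7] -/
theorem packetAdm_smul (g : PacketAlgebra p k) (hg : ∀ j, dEquiv p k g j ≠ 0) {A : Set (PacketAlgebra p k)}
    (hA : PacketAdm p k A) : PacketAdm p k (g • A) := by
  have hO := packetAdm_smul_normalizedPacket p k g hg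
  refine ⟨?_, ?_⟩
  · rw [packetVol_smul p k g hg]
    exact ENNReal.mul_pos hO.1.ne' hA.1.ne'
  · rw [packetVol_smul p k g hg]
    exact ENNReal.mul_lt_top hO.2 hA.2

/-- And conversely (translate back by the inverse). [cite: DupuyHilado2025, §3.7] -/
theorem packetAdm_of_smul (g : PacketAlgebra p k) (hg : ∀ j, dEquiv p k g j ≠ 0) {A : Set (PacketAlgebra p k)}
    (hA : PacketAdm p k (g • A)) : PacketAdm p k A := by
  have hO := packetAdm_smul_normalizedPacket p k g hg
  have h := packetVol_smul p k g hg A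
  refine ⟨?_, ?_⟩
  · by_contra h0
    rw [not_lt, nonpos_iff_eq_zero] at h0
    rw [h0, mul_zero] at h
    exact hA.1.ne' h
  · by_contra htop
    rw [not_lt, top_le_iff] at htop
    rw [htop, ENNReal.mul_top hO.1.ne'] at h
    exact hA.2.ne h

/-- **`log μ̄(g·A) = log μ̄(g·(R_I)^∼) + log μ̄(A)`** for nondegenerate `g` and admissible `A`.
[cite: DupuyHilado2025, §3.7] -/
theorem packetLogμ_smul (g : PacketAlgebra p k) (hg : ∀ j, dEquiv p k g j ≠ 0) {A : Set (PacketAlgebra p k)}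
    (hA : PacketAdm p k A) :
    packetLogμ p k (g • A) =
      packetLogμ p k (g • (normalizedPacket p k : Set (PacketAlgebra p k))) + packetLogμ p k A := by
  have hO := packetAdm_smul_normalizedPacket p k g hg
  simp only [packetLogμ_eq, IntegralStructure.normalizedLogVolume, IntegralStructure.logVolume]
  rw [← add_div]
  congr 1
  have h := packetVol_smul p k g hg A
  unfold PacketAdm packetVol at h hO hA
  rw [h, ENNReal.toReal_mul, Real.log_mul (ENNReal.toReal_pos hO.1.ne' hO.2.ne).ne'
    (ENNReal.toReal_pos hA.1.ne' hA.2.ne).ne']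

/-- `log μ̄(g·(R_I)^∼) = Σ_j (e_j f_j/D)·log ‖ψ(g)_j‖`. [cite: Mochizuki2012, IUTchIV Prop. 1.4 (iii) proof p. 14] -/
theorem packetLogμ_smul_normalizedPacket (g : PacketAlgebra p k) (hg : ∀ j, dEquiv p k g j ≠ 0) :
    packetLogμ p k (g • (normalizedPacket p k : Set (PacketAlgebra p k))) =
      ∑ j, ((packetDegree p (DFac p k) : ℝ))⁻¹ *
        (((absRamificationIdx p (DFac p k j) : ℝ) * residueDegree p (DFac p k j)) *
          Real.log ‖dEquiv p k g j‖) :=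
  packetLogVolume_smul_normalizedPacket p k (DFac p k) (dEquiv p k) g hg

omit [∀ i, IsUltrametricDist (k i)] [Nonempty I] in
/-- The components of `ψ(ι_i(a))` are the images of `a` under the isometric embeddings `k_i → L_j`: they have
norm `‖a‖`, hence are nonzero for `a ≠ 0`. [cite: Mochizuki2012, IUTchIV Prop. 1.4 (i) p. 13] -/
theorem norm_dEquiv_iota (i : I) (a : k i) (j : DIdx p k) : ‖dEquiv p k (iota p k i a) j‖ = ‖a‖ :=
  norm_factorEmb p k (DFac p k) (dEquiv p k) i j a

omit [∀ i, IsUltrametricDist (k i)] [Nonempty I] in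
/-- `ψ(ι_i(a))_j ≠ 0` for `a ≠ 0`. [cite: Mochizuki2012, IUTchIV Prop. 1.4 (i) p. 13] -/
theorem dEquiv_iota_ne_zero (i : I) {a : k i} (ha : a ≠ 0) (j : DIdx p k) : dEquiv p k (iota p k i a) j ≠ 0 := by
  rw [← norm_pos_iff, norm_dEquiv_iota]
  exact norm_pos_iff.mpr ha

/-- **(3.7): `log μ̄(ι_i(a)·(R_I)^∼) = log ‖a‖`** (every factor sees `‖a‖`; the weights sum to `1`).
[cite: DupuyHilado2025, §3.4, §3.7] -/
theorem packetLogμ_iota_smul_normalizedPacket (i : I) {a : k i} (ha : a ≠ 0) :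
    packetLogμ p k (iota p k i a • (normalizedPacket p k : Set (PacketAlgebra p k))) = Real.log ‖a‖ := by
  rw [packetLogμ_smul_normalizedPacket p k _ (dEquiv_iota_ne_zero p k i ha)]
  simp_rw [norm_dEquiv_iota]
  have h := sum_weight_mul_degree p (DFac p k)
  calc ∑ j, ((packetDegree p (DFac p k) : ℝ))⁻¹ *
        (((absRamificationIdx p (DFac p k j) : ℝ) * residueDegree p (DFac p k j)) * Real.log ‖a‖)
      = Real.log ‖a‖ * ∑ j, ((packetDegree p (DFac p k) : ℝ))⁻¹ *
          ((absRamificationIdx p (DFac p k j) : ℝ) * residueDegree p (DFac p k j)) := by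
        rw [Finset.mul_sum]
        exact Finset.sum_congr rfl fun j _ ↦ by ring
    _ = Real.log ‖a‖ := by rw [h, mul_one]

/-- **(3.7) with admissible `U`: `log μ̄(ι_i(a)·U) = log ‖a‖ + log μ̄(U)`** — Dupuy–Hilado's "action of
`a_{v̲}` through a tensor factor" with `ln|a|_p = log ‖a‖` (the norm on `k_i` extends `|·|_p`).
[cite: DupuyHilado2025, §3.7] -/
theorem packetLogμ_iota_smul (i : I) {a : k i} (ha : a ≠ 0) {U : Set (PacketAlgebra p k)}
    (hU : PacketAdm p k U) :
    packetLogμ p k (iota p k i a • U) = Real.log ‖a‖ + packetLogμ p k U := by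
  rw [packetLogμ_smul p k _ (dEquiv_iota_ne_zero p k i ha) hU, packetLogμ_iota_smul_normalizedPacket p k i ha]

/-- `ι_i(a)·U` is admissible for `a ≠ 0` and admissible `U`. [cite: DupuyHilado2025, §3.7] -/
theorem packetAdm_iota_smul (i : I) {a : k i} (ha : a ≠ 0) {U : Set (PacketAlgebra p k)}
    (hU : PacketAdm p k U) : PacketAdm p k (iota p k i a • U) :=
  packetAdm_smul p k _ (dEquiv_iota_ne_zero p k i ha) hU

end Translate

/-! ## Scalars: `c·A` for `c ∈ ℚ_p^×`, and `p^n` -/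

section Scalar

variable [Nonempty I]

omit [Fintype I] [DecidableEq I] [∀ i, IsUltrametricDist (k i)] [∀ i, ProperSpace (k i)] [Nonempty I] in
/-- `c • A = (algebraMap c)·A` as subsets of `V`. [cite: DupuyHilado2025, §3.7] -/
theorem smul_set_eq_algebraMap_smul (c : ℚ_[p]) (A : Set (PacketAlgebra p k)) :
    c • A = algebraMap ℚ_[p] (PacketAlgebra p k) c • A := by
  rw [← Set.image_smul, ← Set.image_smul]
  exact Set.image_congr fun y _ => by rw [Algebra.smul_def, smul_eq_mul]

omit [DecidableEq I] [∀ i, IsUltrametricDist (k i)] [Nonempty I] in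
/-- `ψ(c·1)_j = c ≠ 0`. [cite: DupuyHilado2025, §3.7] -/
theorem dEquiv_algebraMap_ne_zero {c : ℚ_[p]} (hc : c ≠ 0) (j : DIdx p k) :
    dEquiv p k (algebraMap ℚ_[p] (PacketAlgebra p k) c) j ≠ 0 := by
  rw [AlgEquiv.commutes, Pi.algebraMap_apply]
  exact (map_ne_zero (algebraMap ℚ_[p] (DFac p k j))).mpr hc

/-- Scalar multiples `c·A`, `c ≠ 0`, of admissible sets are admissible. [cite: DupuyHilado2025, §3.7] -/
theorem packetAdm_const_smul {c : ℚ_[p]} (hc : c ≠ 0) {A : Set (PacketAlgebra p k)} (hA : PacketAdm p k A) :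
    PacketAdm p k (c • A) := by
  rw [smul_set_eq_algebraMap_smul]
  exact packetAdm_smul p k _ (dEquiv_algebraMap_ne_zero p k hc) hA

/-- … and conversely. [cite: DupuyHilado2025, §3.7] -/
theorem packetAdm_of_const_smul {c : ℚ_[p]} (hc : c ≠ 0) {A : Set (PacketAlgebra p k)}
    (hA : PacketAdm p k (c • A)) : PacketAdm p k A := by
  rw [smul_set_eq_algebraMap_smul] at hA
  exact packetAdm_of_smul p k _ (dEquiv_algebraMap_ne_zero p k hc) hA

/-- **"Mochizuki normalized"**: `log μ̄(p^n·A) = −n·log p + log μ̄(A)` for admissible `A` (Dupuy–Hilado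
Rmk. 3.5.4 / Lemma 3.5.5 in the model; [IUTchIV] Prop. 1.4 (i) `μ^log(p·(R_E)^∼) = −log p`).
[cite: DupuyHilado2025, Rmk. 3.5.4] -/
theorem packetLogμ_ppow_smul (n : ℤ) {A : Set (PacketAlgebra p k)} (hA : PacketAdm p k A) :
    packetLogμ p k (ppow p k n • A) = -(n * Real.log p) + packetLogμ p k A := by
  have hg : ∀ j, dEquiv p k (ppow p k n) j ≠ 0 := fun j => by
    rw [psi_ppow_apply]
    exact zpow_ne_zero _ (prime_ne_zero p (DFac p k j))
  rw [packetLogμ_smul p k _ hg hA]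
  congr 1
  have h := packetLogVolume_ppow_mul_purePacket_smul p k (DFac p k) (dEquiv p k) n 1
    (fun _ => one_ne_zero)
  rw [purePacket_one, mul_one] at h
  rw [packetLogμ, h]
  simp

end Scalar

end Literature.IUT.LogVolume

end
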